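import Mathlib
import Summits.Ventures.PercRepro2.GradedSP
import Summits.Ventures.PercRepro2.UniversalTransport
import Summits.Ventures.PercRepro2.UniversalThetaMulti

/-! # (UH*) on every series–parallel network of max flow ≤ 2
(seat mine-b, cell pub-perc-repro2; MINE-B.md §23)

The **flow** of a series–parallel term is the recursive capacity `flow(free) = 1`, `flow(pin) = 2` (a pinned edge
carries a red and a blue unit at once), `flow(absent) = 0`, minima in series, sums in parallel; on a network of
free edges it is the maximum number of edge-disjoint `s`–`t` paths.  Every configuration has
`rLab + bLab ≤ flow` (`SP.lab_le_flow`), so a term of flow `≤ 1` has all labels `≤ 1` and a parallel node of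
flow `2` with both children of flow `1` has the multi-top theta structure `ThetaData2` of UniversalThetaMulti.lean:
the tops are the pairs `(u, v)` with `β₁ u = β₂ v = 1`, the private triple of a top is `(σ₁ u, σ₂ v)`,
`(u, σ₂ v)`, `(σ₁ u, v)` with `σ_i` the level-1 Harris assignment of the part (`exists_harris_map`), and the relay
of a `(0,1)`-element is the same assignment on its blue side (`thetaPar`).

**THEOREM** (`SP.universal_of_flow_le_two`): every series–parallel network `N` with `flow N ≤ 2` satisfies the
universal level-conditioned Hall statement (UH*) `Universal N.rLab N.bLab`: every configuration with red flow
`0` and blue flow `a ≥ 1` owns `a` private sub-configurations of red flow exactly `1` and blue flow `≥ a − 1`.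
Proof: `SP.universal_ser_of_flow_le_two` — for EVERY series–parallel `X` and every `Y` of flow `≤ 2`, `X ∧ Y`
satisfies (UH*) (induction on `Y`: atoms by `universal_ser_unit`; a series node by re-association
`X ∧ (Y₁ ∧ Y₂) ≅ (X ∧ Y₁) ∧ Y₂` or `≅ (X ∧ Y₂) ∧ Y₁`, whichever child has flow `≤ 2`, with
`universal_transport`; a parallel node of flow `≤ 2` either has a dead child — a dummy coordinate,
`universal_dummy` — or two flow-1 children — `universal_theta2` with `SP.gDom 1`, `SP.vDom 2`, the level
Harris inequalities of `SP.graded`); then the network itself: atoms directly, a parallel node by `universal_par`,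
a series node by the series lemma on the child of flow `≤ 2` (commuting the factors if needed). -/

namespace Summit.Ventures.PercRepro2.UHClosure

open Finset

/-! ### the multi-top theta structure of a parallel product of two unit-labelled posets -/

section thetaPar

variable {Y₁ Y₂ : Type*} [Preorder Y₁] [Preorder Y₂]
variable (ρ₁ β₁ : Y₁ → ℕ) (ρ₂ β₂ : Y₂ → ℕ)

/-- **the `ThetaData2` of `Y₁ ∗ Y₂`** for unit-labelled parts (`ρ + β ≤ 1`) with level-1 Harris assignments
`σ₁`, `σ₂` (`σ y ≤ y`, `ρ (σ y) ≥ 1` whenever `β y ≥ 1`, injective there) -/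
def thetaPar (h₁ : ∀ y, ρ₁ y + β₁ y ≤ 1) (h₂ : ∀ y, ρ₂ y + β₂ y ≤ 1)
    (σ₁ : Y₁ → Y₁) (hσ₁ : ∀ y, 1 ≤ β₁ y → σ₁ y ≤ y ∧ 1 ≤ ρ₁ (σ₁ y))
    (hσ₁i : ∀ y y', 1 ≤ β₁ y → 1 ≤ β₁ y' → σ₁ y = σ₁ y' → y = y')
    (σ₂ : Y₂ → Y₂) (hσ₂ : ∀ y, 1 ≤ β₂ y → σ₂ y ≤ y ∧ 1 ≤ ρ₂ (σ₂ y))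
    (hσ₂i : ∀ y y', 1 ≤ β₂ y → 1 ≤ β₂ y' → σ₂ y = σ₂ y' → y = y') :
    ThetaData2 (parR ρ₁ ρ₂) (parB β₁ β₂) where
  hlab := fun p => by
    have := h₁ p.1; have := h₂ p.2
    simp only [parR, parB]; omega
  y00 := fun p => (σ₁ p.1, σ₂ p.2)
  yA := fun p => (p.1, σ₂ p.2)
  yB := fun p => (σ₁ p.1, p.2)
  τ := fun p => if 1 ≤ β₁ p.1 then (σ₁ p.1, p.2) else (p.1, σ₂ p.2)
  h00 := fun p hρ hβ => by
    obtain ⟨u, v⟩ := p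
    simp only [parR, parB] at hρ hβ ⊢
    have hu := h₁ u; have hv := h₂ v
    obtain ⟨l₁, r₁⟩ := hσ₁ u (by omega)
    obtain ⟨l₂, r₂⟩ := hσ₂ v (by omega)
    have := h₁ (σ₁ u); have := h₂ (σ₂ v)
    exact ⟨Prod.mk_le_mk.2 ⟨l₁, l₂⟩, by omega, by omega⟩
  hA := fun p hρ hβ => by
    obtain ⟨u, v⟩ := p
    simp only [parR, parB] at hρ hβ ⊢
    have hu := h₁ u; have hv := h₂ v
    obtain ⟨l₂, r₂⟩ := hσ₂ v (by omega)
    have := h₂ (σ₂ v)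
    exact ⟨Prod.mk_le_mk.2 ⟨le_rfl, l₂⟩, by omega, by omega⟩
  hB := fun p hρ hβ => by
    obtain ⟨u, v⟩ := p
    simp only [parR, parB] at hρ hβ ⊢
    have hu := h₁ u; have hv := h₂ v
    obtain ⟨l₁, r₁⟩ := hσ₁ u (by omega)
    have := h₁ (σ₁ u)
    exact ⟨Prod.mk_le_mk.2 ⟨l₁, le_rfl⟩, by omega, by omega⟩
  h00inj := fun p p' hρ hβ hρ' hβ' he => by
    obtain ⟨u, v⟩ := p; obtain ⟨u', v'⟩ := p'
    simp only [parR, parB] at hρ hβ hρ' hβ'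
    dsimp only at he
    have hu := h₁ u; have hv := h₂ v; have hu' := h₁ u'; have hv' := h₂ v'
    obtain ⟨e1, e2⟩ := Prod.mk.inj he
    rw [hσ₁i u u' (by omega) (by omega) e1, hσ₂i v v' (by omega) (by omega) e2]
  hAinj := fun p p' hρ hβ hρ' hβ' he => by
    obtain ⟨u, v⟩ := p; obtain ⟨u', v'⟩ := p'
    simp only [parR, parB] at hρ hβ hρ' hβ'
    dsimp only at he
    have hu := h₁ u; have hv := h₂ v; have hu' := h₁ u'; have hv' := h₂ v'
    obtain ⟨e1, e2⟩ := Prod.mk.inj he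
    rw [e1, hσ₂i v v' (by omega) (by omega) e2]
  hBinj := fun p p' hρ hβ hρ' hβ' he => by
    obtain ⟨u, v⟩ := p; obtain ⟨u', v'⟩ := p'
    simp only [parR, parB] at hρ hβ hρ' hβ'
    dsimp only at he
    have hu := h₁ u; have hv := h₂ v; have hu' := h₁ u'; have hv' := h₂ v'
    obtain ⟨e1, e2⟩ := Prod.mk.inj he
    rw [hσ₁i u u' (by omega) (by omega) e1, e2]
  hAB := fun p p' hρ hβ hρ' hβ' he => by
    obtain ⟨u, v⟩ := p; obtain ⟨u', v'⟩ := p'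
    simp only [parR, parB] at hρ hβ hρ' hβ'
    dsimp only at he
    have hu := h₁ u; have hv := h₂ v; have hu' := h₁ u'; have hv' := h₂ v'
    obtain ⟨e1, _⟩ := Prod.mk.inj he
    obtain ⟨_, r₁⟩ := hσ₁ u' (by omega)
    have := h₁ (σ₁ u')
    rw [← e1] at r₁ this
    omega
  hτ := fun p hρ hβ => by
    obtain ⟨u, w⟩ := p
    simp only [parR, parB] at hρ hβ ⊢
    have hu := h₁ u; have hw := h₂ w
    by_cases hb : 1 ≤ β₁ u
    · obtain ⟨l₁, r₁⟩ := hσ₁ u hb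
      have := h₁ (σ₁ u)
      simp only [hb, if_true]
      exact ⟨Prod.mk_le_mk.2 ⟨l₁, le_rfl⟩, by omega, by omega⟩
    · obtain ⟨l₂, r₂⟩ := hσ₂ w (by omega)
      have := h₂ (σ₂ w)
      simp only [hb, if_false]
      exact ⟨Prod.mk_le_mk.2 ⟨le_rfl, l₂⟩, by omega, by omega⟩
  hτinj := fun p p' hρ hβ hρ' hβ' he => by
    obtain ⟨u, w⟩ := p; obtain ⟨u', w'⟩ := p'
    simp only [parR, parB] at hρ hβ hρ' hβ'
    dsimp only at he
    have hu := h₁ u; have hw := h₂ w; have hu' := h₁ u'; have hw' := h₂ w'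
    by_cases hb : 1 ≤ β₁ u <;> by_cases hb' : 1 ≤ β₁ u'
    · simp only [hb, hb', if_true] at he
      obtain ⟨e1, e2⟩ := Prod.mk.inj he
      rw [hσ₁i u u' hb hb' e1, e2]
    · simp only [hb, hb', if_true, if_false] at he
      obtain ⟨e1, _⟩ := Prod.mk.inj he
      obtain ⟨_, r₁⟩ := hσ₁ u hb
      rw [e1] at r₁
      omega
    · simp only [hb, hb', if_true, if_false] at he
      obtain ⟨e1, _⟩ := Prod.mk.inj he
      obtain ⟨_, r₁⟩ := hσ₁ u' hb'
      rw [← e1] at r₁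
      omega
    · simp only [hb, hb', if_false] at he
      obtain ⟨e1, e2⟩ := Prod.mk.inj he
      rw [e1, hσ₂i w w' (by omega) (by omega) e2]

end thetaPar

end Summit.Ventures.PercRepro2.UHClosure

namespace Summit.Ventures.PercRepro2.V2Closure

open Finset
open Summit.Ventures.PercRepro2.UHClosure

/-! ### the flow of a series–parallel term -/

/-- the **flow** (capacity) of a series–parallel term: `1` for a free edge, `2` for a pinned edge (a red and a
blue unit at once), `0` for an absent edge, minima in series, sums in parallel; on a network of free edges the
maximum number of edge-disjoint `s`–`t` paths -/
def SP.flow : SP → ℕ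
  | .free => 1
  | .pin => 2
  | .absent => 0
  | .ser s t => min s.flow t.flow
  | .par s t => s.flow + t.flow

/-- every configuration has `rLab + bLab ≤ flow` -/
theorem SP.lab_le_flow : ∀ (s : SP) (c : s.Conf), s.rLab c + s.bLab c ≤ s.flow
  | .free, c => by cases c <;> simp [SP.rLab, SP.bLab, SP.flow]
  | .pin, _ => by simp [SP.rLab, SP.bLab, SP.flow]
  | .absent, _ => by simp [SP.rLab, SP.bLab, SP.flow]
  | .ser s t, c => by
      have h1 := SP.lab_le_flow s c.1
      have h2 := SP.lab_le_flow t c.2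
      simp only [SP.rLab, SP.bLab, SP.flow, serR, serB]
      omega
  | .par s t, c => by
      have h1 := SP.lab_le_flow s c.1
      have h2 := SP.lab_le_flow t c.2
      simp only [SP.rLab, SP.bLab, SP.flow, parR, parB]
      omega

/-- the labels of a term of flow `≤ 1` are `≤ 1` -/
theorem SP.rLab_le_one (s : SP) (h : s.flow ≤ 1) (c : s.Conf) : s.rLab c ≤ 1 := by
  have := SP.lab_le_flow s c; omega

/-- the labels of a term of flow `≤ 1` are `≤ 1` -/
theorem SP.bLab_le_one (s : SP) (h : s.flow ≤ 1) (c : s.Conf) : s.bLab c ≤ 1 := by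
  have := SP.lab_le_flow s c; omega

/-! ### the label identities behind the transports -/

/-- the red label of a series product, as a function of the parts -/
theorem SP.rLab_ser (X Y : SP) : (SP.ser X Y).rLab = fun p => min (X.rLab p.1) (Y.rLab p.2) := rfl

/-- the blue label of a series product, as a function of the parts -/
theorem SP.bLab_ser (X Y : SP) : (SP.ser X Y).bLab = fun p => min (X.bLab p.1) (Y.bLab p.2) := rfl

/-- the red label of a parallel product, as a function of the parts -/
theorem SP.rLab_par (X Y : SP) : (SP.par X Y).rLab = fun p => X.rLab p.1 + Y.rLab p.2 := rfl

/-- the blue label of a parallel product, as a function of the parts -/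
theorem SP.bLab_par (X Y : SP) : (SP.par X Y).bLab = fun p => X.bLab p.1 + Y.bLab p.2 := rfl

/-- the order isomorphism `(X × Y₂) × Y₁ ≃o X × (Y₁ × Y₂)` behind the commuted re-association -/
def serSwap (X Y₁ Y₂ : SP) : (X.Conf × Y₂.Conf) × Y₁.Conf ≃o X.Conf × (Y₁.Conf × Y₂.Conf) where
  toFun p := (p.1.1, (p.2, p.1.2))
  invFun q := ((q.1, q.2.2), q.2.1)
  left_inv _ := rfl
  right_inv _ := rfl
  map_rel_iff' := by
    intro p q
    simp only [Equiv.coe_fn_mk, Prod.le_def]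
    tauto

/-- re-association: the labels of `X ∧ (Y₁ ∧ Y₂)` are those of `(X ∧ Y₁) ∧ Y₂` along `prodAssoc` -/
theorem SP.rLab_assoc (X Y₁ Y₂ : SP) :
    (SP.ser X (SP.ser Y₁ Y₂)).rLab
      = (SP.ser (SP.ser X Y₁) Y₂).rLab ∘ (OrderIso.prodAssoc X.Conf Y₁.Conf Y₂.Conf).symm := by
  funext p; obtain ⟨x, y₁, y₂⟩ := p
  exact (min_assoc (X.rLab x) (Y₁.rLab y₁) (Y₂.rLab y₂)).symm

/-- re-association, blue labels -/
theorem SP.bLab_assoc (X Y₁ Y₂ : SP) :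
    (SP.ser X (SP.ser Y₁ Y₂)).bLab
      = (SP.ser (SP.ser X Y₁) Y₂).bLab ∘ (OrderIso.prodAssoc X.Conf Y₁.Conf Y₂.Conf).symm := by
  funext p; obtain ⟨x, y₁, y₂⟩ := p
  exact (min_assoc (X.bLab x) (Y₁.bLab y₁) (Y₂.bLab y₂)).symm

/-- commuted re-association: the labels of `X ∧ (Y₁ ∧ Y₂)` are those of `(X ∧ Y₂) ∧ Y₁` along `serSwap` -/
theorem SP.rLab_swap (X Y₁ Y₂ : SP) :
    (SP.ser X (SP.ser Y₁ Y₂)).rLab = (SP.ser (SP.ser X Y₂) Y₁).rLab ∘ (serSwap X Y₁ Y₂).symm := by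
  funext p; obtain ⟨x, y₁, y₂⟩ := p
  show min (X.rLab x) (min (Y₁.rLab y₁) (Y₂.rLab y₂)) = min (min (X.rLab x) (Y₂.rLab y₂)) (Y₁.rLab y₁)
  rw [min_assoc, min_comm (Y₁.rLab y₁)]

/-- commuted re-association, blue labels -/
theorem SP.bLab_swap (X Y₁ Y₂ : SP) :
    (SP.ser X (SP.ser Y₁ Y₂)).bLab = (SP.ser (SP.ser X Y₂) Y₁).bLab ∘ (serSwap X Y₁ Y₂).symm := by
  funext p; obtain ⟨x, y₁, y₂⟩ := p
  show min (X.bLab x) (min (Y₁.bLab y₁) (Y₂.bLab y₂)) = min (min (X.bLab x) (Y₂.bLab y₂)) (Y₁.bLab y₁)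
  rw [min_assoc, min_comm (Y₁.bLab y₁)]

/-- a dead second child (all labels `0`): the labels of `X ∧ (Y₁ ∗ Y₂)` are those of `X ∧ Y₁` with a dummy
coordinate, along `prodAssoc` -/
theorem SP.rLab_par_dead₂ (X Y₁ Y₂ : SP) (h : ∀ c, Y₂.rLab c = 0) :
    (SP.ser X (SP.par Y₁ Y₂)).rLab
      = (fun p : (X.Conf × Y₁.Conf) × Y₂.Conf => (SP.ser X Y₁).rLab p.1)
          ∘ (OrderIso.prodAssoc X.Conf Y₁.Conf Y₂.Conf).symm := by
  funext p; obtain ⟨x, y₁, y₂⟩ := p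
  show min (X.rLab x) (Y₁.rLab y₁ + Y₂.rLab y₂) = min (X.rLab x) (Y₁.rLab y₁)
  rw [h y₂, add_zero]

/-- a dead second child, blue labels -/
theorem SP.bLab_par_dead₂ (X Y₁ Y₂ : SP) (h : ∀ c, Y₂.bLab c = 0) :
    (SP.ser X (SP.par Y₁ Y₂)).bLab
      = (fun p : (X.Conf × Y₁.Conf) × Y₂.Conf => (SP.ser X Y₁).bLab p.1)
          ∘ (OrderIso.prodAssoc X.Conf Y₁.Conf Y₂.Conf).symm := by
  funext p; obtain ⟨x, y₁, y₂⟩ := p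
  show min (X.bLab x) (Y₁.bLab y₁ + Y₂.bLab y₂) = min (X.bLab x) (Y₁.bLab y₁)
  rw [h y₂, add_zero]

/-- a dead first child: the labels of `X ∧ (Y₁ ∗ Y₂)` are those of `X ∧ Y₂` with a dummy coordinate, along
`serSwap` -/
theorem SP.rLab_par_dead₁ (X Y₁ Y₂ : SP) (h : ∀ c, Y₁.rLab c = 0) :
    (SP.ser X (SP.par Y₁ Y₂)).rLab
      = (fun p : (X.Conf × Y₂.Conf) × Y₁.Conf => (SP.ser X Y₂).rLab p.1) ∘ (serSwap X Y₁ Y₂).symm := by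
  funext p; obtain ⟨x, y₁, y₂⟩ := p
  show min (X.rLab x) (Y₁.rLab y₁ + Y₂.rLab y₂) = min (X.rLab x) (Y₂.rLab y₂)
  rw [h y₁, zero_add]

/-- a dead first child, blue labels -/
theorem SP.bLab_par_dead₁ (X Y₁ Y₂ : SP) (h : ∀ c, Y₁.bLab c = 0) :
    (SP.ser X (SP.par Y₁ Y₂)).bLab
      = (fun p : (X.Conf × Y₂.Conf) × Y₁.Conf => (SP.ser X Y₂).bLab p.1) ∘ (serSwap X Y₁ Y₂).symm := by
  funext p; obtain ⟨x, y₁, y₂⟩ := p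
  show min (X.bLab x) (Y₁.bLab y₁ + Y₂.bLab y₂) = min (X.bLab x) (Y₂.bLab y₂)
  rw [h y₁, zero_add]

/-- commutation: the labels of `X ∧ Y` are those of `Y ∧ X` along `prodComm` -/
theorem SP.rLab_comm (X Y : SP) :
    (SP.ser X Y).rLab = (SP.ser Y X).rLab ∘ (OrderIso.prodComm : Y.Conf × X.Conf ≃o X.Conf × Y.Conf).symm := by
  funext p; obtain ⟨x, y⟩ := p
  exact min_comm (X.rLab x) (Y.rLab y)

/-- commutation, blue labels -/
theorem SP.bLab_comm (X Y : SP) :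
    (SP.ser X Y).bLab = (SP.ser Y X).bLab ∘ (OrderIso.prodComm : Y.Conf × X.Conf ≃o X.Conf × Y.Conf).symm := by
  funext p; obtain ⟨x, y⟩ := p
  exact min_comm (X.bLab x) (Y.bLab y)

/-! ### the series lemma and the theorem -/

/-- **the series lemma**: for every series–parallel `X` and every `Y` of flow `≤ 2`, `X ∧ Y` satisfies (UH*) -/
theorem SP.universal_ser_of_flow_le_two :
    ∀ (Y : SP), Y.flow ≤ 2 → ∀ X : SP, Universal (SP.ser X Y).rLab (SP.ser X Y).bLab
  | .free, _, X =>
      universal_ser_unit X.rLab X.bLab SP.free.rLab SP.free.bLab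
        (SP.rLab_le_one SP.free (by simp [SP.flow])) (SP.bLab_le_one SP.free (by simp [SP.flow]))
        (SP.graded X).2.1 (SP.graded SP.free).2.1
  | .pin, _, X =>
      universal_ser_unit X.rLab X.bLab SP.pin.rLab SP.pin.bLab
        (fun _ => by simp [SP.rLab]) (fun _ => by simp [SP.bLab])
        (SP.graded X).2.1 (SP.graded SP.pin).2.1
  | .absent, _, X =>
      universal_ser_unit X.rLab X.bLab SP.absent.rLab SP.absent.bLab
        (fun _ => by simp [SP.rLab]) (fun _ => by simp [SP.bLab])
        (SP.graded X).2.1 (SP.graded SP.absent).2.1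
  | .ser Y₁ Y₂, hf, X => by
      by_cases h2 : Y₂.flow ≤ 2
      · have ih := SP.universal_ser_of_flow_le_two Y₂ h2 (SP.ser X Y₁)
        rw [SP.rLab_assoc, SP.bLab_assoc]
        exact universal_transport _ _ _ ih
      · have h1 : Y₁.flow ≤ 2 := by simp only [SP.flow] at hf; omega
        have ih := SP.universal_ser_of_flow_le_two Y₁ h1 (SP.ser X Y₂)
        rw [SP.rLab_swap, SP.bLab_swap]
        exact universal_transport _ _ _ ih
  | .par Y₁ Y₂, hf, X => by
      simp only [SP.flow] at hf
      by_cases h20 : Y₂.flow = 0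
      · have ih := SP.universal_ser_of_flow_le_two Y₁ (by omega) X
        rw [SP.rLab_par_dead₂ X Y₁ Y₂ (fun c => by have := SP.lab_le_flow Y₂ c; omega),
          SP.bLab_par_dead₂ X Y₁ Y₂ (fun c => by have := SP.lab_le_flow Y₂ c; omega)]
        exact universal_transport _ _ _ (universal_dummy _ _ ih)
      by_cases h10 : Y₁.flow = 0
      · have ih := SP.universal_ser_of_flow_le_two Y₂ (by omega) X
        rw [SP.rLab_par_dead₁ X Y₁ Y₂ (fun c => by have := SP.lab_le_flow Y₁ c; omega),
          SP.bLab_par_dead₁ X Y₁ Y₂ (fun c => by have := SP.lab_le_flow Y₁ c; omega)]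
        exact universal_transport _ _ _ (universal_dummy _ _ ih)
      · -- both children have flow 1: the multi-top theta structure
        obtain ⟨σ₁, hσ₁, hσ₁i⟩ := exists_harris_map Y₁.rLab Y₁.bLab (SP.graded Y₁).2.1
        obtain ⟨σ₂, hσ₂, hσ₂i⟩ := exists_harris_map Y₂.rLab Y₂.bLab (SP.graded Y₂).2.1
        have D := thetaPar Y₁.rLab Y₁.bLab Y₂.rLab Y₂.bLab
          (fun c => by have := SP.lab_le_flow Y₁ c; omega) (fun c => by have := SP.lab_le_flow Y₂ c; omega)
          σ₁ hσ₁ hσ₁i σ₂ hσ₂ hσ₂i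
        exact universal_theta2 X.rLab X.bLab _ _ D (SP.gDom 1 X) (SP.vDom 2 le_rfl X) (SP.graded X).2.1

/-- (UH*) on a free edge: the blue state owns the red state -/
theorem SP.universal_free : Universal SP.free.rLab SP.free.bLab := by
  refine ⟨fun _ => false, ?_, ?_⟩
  · intro q q' _
    have hq : q.1.1.1 = true := by
      have := q.1.1.2.1.1; cases h : q.1.1.1 <;> simp [SP.rLab, h] at this ⊢
    have hq' : q'.1.1.1 = true := by
      have := q'.1.1.2.1.1; cases h : q'.1.1.1 <;> simp [SP.rLab, h] at this ⊢
    have hi : q.1.2.val = 0 := by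
      have := q.2; rw [hq] at this; simp [SP.bLab] at this; omega
    have hi' : q'.1.2.val = 0 := by
      have := q'.2; rw [hq'] at this; simp [SP.bLab] at this; omega
    exact slotL_ext q q' (hq.trans hq'.symm) (hi.trans hi'.symm)
  · intro q
    have hq : q.1.1.1 = true := by
      have := q.1.1.2.1.1; cases h : q.1.1.1 <;> simp [SP.rLab, h] at this ⊢
    refine ⟨by rw [hq]; exact Bool.false_le _, by simp [SP.rLab], ?_⟩
    rw [hq]; simp [SP.bLab]

/-- (UH*) on a pinned edge: no source -/
theorem SP.universal_pin : Universal SP.pin.rLab SP.pin.bLab := by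
  refine ⟨fun q => q.1.1.1, ?_, ?_⟩
  · intro q _ _
    exact absurd q.1.1.2.1.1 (by simp [SP.rLab])
  · intro q
    exact absurd q.1.1.2.1.1 (by simp [SP.rLab])

/-- (UH*) on an absent edge: no source -/
theorem SP.universal_absent : Universal SP.absent.rLab SP.absent.bLab := by
  refine ⟨fun q => q.1.1.1, ?_, ?_⟩
  · intro q _ _
    exact absurd q.1.1.2.1.2 (by simp [SP.bLab])
  · intro q
    exact absurd q.1.1.2.1.2 (by simp [SP.bLab])

/-- **THEOREM: (UH*) holds on every series–parallel network of flow `≤ 2`** — every configuration with red flow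
`0` and blue flow `a ≥ 1` owns `a` private sub-configurations of red flow exactly `1` and blue flow `≥ a − 1`. -/
theorem SP.universal_of_flow_le_two : ∀ N : SP, N.flow ≤ 2 → Universal N.rLab N.bLab
  | .free, _ => SP.universal_free
  | .pin, _ => SP.universal_pin
  | .absent, _ => SP.universal_absent
  | .ser s t, hf => by
      by_cases ht : t.flow ≤ 2
      · exact SP.universal_ser_of_flow_le_two t ht s
      · have hs : s.flow ≤ 2 := by simp only [SP.flow] at hf; omega
        rw [SP.rLab_comm, SP.bLab_comm]
        exact universal_transport _ _ _ (SP.universal_ser_of_flow_le_two s hs t)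
  | .par s t, hf => by
      simp only [SP.flow] at hf
      exact universal_par s.rLab s.bLab t.rLab t.bLab (SP.universal_of_flow_le_two s (by omega))
        (SP.universal_of_flow_le_two t (by omega))

end Summit.Ventures.PercRepro2.V2Closure
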